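import Summits.HodgeConjecture.CorCM.MumfordTateRankSevenSimpleConverse
import HarnessLib

/-!
# The rung `dim MT(H¹(X)) = 7`, CONVERSE of the quaternion-fourfold position: a simple abelian fourfold `B` with
# `dim_ℚ End⁰B = 8` and real quadratic centre has `dim MT(H¹B) = 7`, and so does every `X ∼ B^{m+1}`

COR-CM (cell `pub-hodgecm2`, seat `b27` gen 42, count-neutral Mumford–Tate-rank ladder; theorems only, no definition, no named
fact; UNCONDITIONAL — nothing here uses or asserts HC_CM).  gen 40 (`CorCM/MumfordTateRankSevenSimpleIsogeny`, position (c))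
proved: `𝔷 = 0`, `dim MT(H¹X) = 7`, `Lie Hg(H¹X)` `ℚ`-simple with grading `(2,2,2)` and `dim_ℚ End⁰` of the simple factor `= 8` ⟹
`X ∼ B^{m+1}` with `B` a simple FOURFOLD, `dim_ℚ End⁰B = 8`, `Z(End⁰B) = ℚ(φ)` a REAL QUADRATIC field (`φ² = q > 0` non-square).
This file proves the CONVERSE, by counting only:

* **`not_isOfCMType_of_hasNoTypeIVFactor`** — a complex abelian variety of positive dimension WITHOUT factor of type IV is
  NOT of CM type (CM ⟹ `𝔪𝔱 ⊆ End_Hdg` ⟹ `Lie Hg ⊆ Lie Hg ∩ End_Hdg = 𝔷 = 0` ⟹ `dim MT = 1 < 2`).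
* **`hasNoTypeIVFactor_of_center_real_quadratic`** — `Z(End⁰B) ⊆ ℚ + ℚφ` with `φ² = q ≥ 0` central ⟹ no factor of type IV
  (every central `a + bφ` is a root of `(T − a)² − b²q`, whose complex roots `a ± b√q` are real).
* **`mtRank_hodge_one_eq_seven_of_isSimple_fourfold_of_finrank_endAlgebra_eq_eight`** — `B` simple, `dim B = 4`,
  `dim_ℚ End⁰B = 8 = 2 dim B`, `Z(End⁰B) ⊆ ℚ + ℚφ`, `φ² = q ≥ 0` ⟹ **`dim MT(H¹B) = 7`**, no type-IV factor, `𝔷 = 0`, not CM.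
  PROOF: `H¹(B)` is free of rank one over the division algebra `End⁰B`, so `dim Lie Hg(H¹B) + 1 ≤ 2 dim B = 8` (gen 34's
  `finrank_hodgeLie_add_one_le_two_mul_dim_of_isSimple`), i.e. `t ≤ 8`; no type IV ⟹ `t ∉ {5, 6, 8}` and not CM ⟹ `t ≥ 4`;
  `t = 4` ⟹ `dim End⁰B = (dim B)² = 16 ≠ 8` (rung 4).  Hence `t = 7`.
* **`mtRank_hodge_one_eq_seven_of_isIsogenous_powSucc_quaternionFourfold`** — the same for every `X ∼ B^{m+1}`
  (`dim Lie Hg(H¹X) ≤ dim Lie Hg(H¹B) = 6`; `X` inherits «no type IV»; `t(X) = 4` would force `dim End⁰X = (dim X)²`), and then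
  `Lie Hg(H¹X)` is `ℚ`-SIMPLE (gen 39's split alternative has simple factors of dimension `≤ 2`, but `B ≼ X` has dimension `4`).
So position (iv) of the rung `t = 7`, `𝔷 = 0` is an IFF at the level of isogeny shapes (with gen 40's forward direction), like
position (iii) (gen 40's RM converse) and position (i) (`CorCM/MumfordTateRankSevenSplitConverse`).

## References

* [MoonenZarhin1999LowDim] B. Moonen, Yu. Zarhin, *Hodge classes on abelian varieties of low dimension*, Math. Ann.
  315 (1999), §1 («`Hg(X) ⊂ Sp_D(V,φ)`», no factors of type IV), §2 (2.3), §3 (3.1).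
* [MumfordAV1970] D. Mumford, *Abelian Varieties* (1970), §19 Thm. 1, Cor. 1–2 (pp. 173–174), §21 (Albert types).
* [Deligne1982HodgeCycles] P. Deligne, *Hodge cycles on abelian varieties*, LNM 900 (1982), I §3.1 and Prop. 3.4, 3.6.
-/

noncomputable section

open scoped TensorProduct
open CategoryTheory CategoryTheory.Limits Module

namespace Summit.HodgeConjecture.CorCM

open Literature.AlgebraicGeometry.Motives
open Literature.AlgebraicGeometry.Motives.AbelianVariety
open Literature.AlgebraicGeometry.Motives.HodgeStructure
open Literature.AlgebraicGeometry.HodgeTheory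
open Literature.AlgebraicGeometry.ComplexMultiplication (isIsogenous_biproduct_powSucc)
open Literature.AlgebraicGeometry.Milne1999 (IsOfCMType)
open Literature.AlgebraicGeometry.Pohlmann1968 (isIsogenous_powSucc_biproduct)
open Summit.HodgeConjecture.CorCM.Domination
open Summit.HodgeConjecture.CorCM.SliceExhaustion (avDominatedBy_prod_left)

variable [HodgeTensorFacts.{0, 0}] {X : AbelianVariety ℂ} {n : ℕ}

/-! ## §1 No factor of type IV excludes CM type -/

/-- **A complex abelian variety of positive dimension WITHOUT factor of type IV is NOT of CM type**: CM type means
`𝔪𝔱(H¹X) ⊆ End_Hdg` (`isOfCMType_iff_mumfordTateLieAlgebra_le_endAlg`), so `Lie Hg ⊆ Lie Hg ∩ End_Hdg = 𝔷`, which vanishes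
without type-IV factors; then `dim MT(H¹X) = dim Lie Hg + 1 = 1`, contradicting `dim MT ≥ 2`.  (A CM abelian variety has only
factors of type IV: its simple factors have CM fields as endomorphism algebras.) [cite: MoonenZarhin1999LowDim, §1]
[cite: Deligne1982HodgeCycles, I Prop. 3.6 and §5] -/
theorem not_isOfCMType_of_hasNoTypeIVFactor (hX : IsSmoothProjective n X.X) (h0 : 0 < X.dim) (hA4 : HasNoTypeIVFactor X) :
    ¬ IsOfCMType X := by
  haveI := BettiUniverse.finite hX 1
  intro hcm
  have hle := (isOfCMType_iff_mumfordTateLieAlgebra_le_endAlg hX).1 hcm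
  have hz := hodgeLie_hodge_one_inf_endAlg_eq_bot_of_hasNoTypeIVFactor hX hA4
  have hbot : (BettiUniverse.hodge exists_isReal_hodgeModel_holds hX 1).hodgeLie = ⊥ := by
    rw [← hz]
    exact (le_inf le_rfl ((hodgeLie_le_mumfordTateLieAlgebra _).trans hle)).antisymm inf_le_left
  have ht := mtRank_hodge_one_eq_finrank_hodgeLie_add_one hX h0
  have h2 := two_le_mtRank_hodge_one hX h0
  rw [hbot, finrank_bot] at ht
  omega

/-! ## §2 A real quadratic centre has no factor of type IV -/

omit [HodgeTensorFacts.{0, 0}] in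
/-- **`Z(End⁰B) ⊆ ℚ + ℚφ` with `φ² = q`, `0 ≤ q`, ⟹ no factor of type IV**: a central `z = a + bφ` satisfies
`(z − a)² = b²q`, so it is a root of the nonzero rational polynomial `(T − a)² − b²q`, whose complex roots `a ± b√q` are real.
[cite: MoonenZarhin1999LowDim, §1] [cite: MumfordAV1970, §21] -/
theorem hasNoTypeIVFactor_of_center_real_quadratic {B : AbelianVariety ℂ} {φ : B.endAlgebra} {q : ℚ} (hq : 0 ≤ q)
    (hφ : φ * φ = algebraMap ℚ B.endAlgebra q)
    (hZ : ∀ z ∈ Subalgebra.center ℚ B.endAlgebra, ∃ a b : ℚ, z = algebraMap ℚ B.endAlgebra a + b • φ) :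
    HasNoTypeIVFactor B := by
  intro z hz
  obtain ⟨a, b, rfl⟩ := hZ z hz
  refine ⟨(Polynomial.X - Polynomial.C a) ^ 2 - Polynomial.C (b ^ 2 * q), ?_, ?_, fun x hx => ?_⟩
  · -- the polynomial is monic of degree two
    intro h
    have h2 := congrArg Polynomial.natDegree h
    rw [Polynomial.natDegree_sub_C, Polynomial.natDegree_pow, Polynomial.natDegree_X_sub_C,
      Polynomial.natDegree_zero] at h2
    exact absurd h2 (by norm_num)
  · -- `(z − a)² = b² q`
    simp only [map_sub, map_pow, Polynomial.aeval_X, Polynomial.aeval_C, add_sub_cancel_left]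
    rw [smul_pow, pow_two φ, hφ, Algebra.smul_def, ← map_mul, sub_self]
  · -- a complex root `x` has `(x − a)² = b² q ≥ 0`, hence is real
    simp only [map_sub, map_pow, Polynomial.aeval_X, Polynomial.aeval_C, sub_eq_zero] at hx
    set w : ℂ := x - algebraMap ℚ ℂ a with hw
    have hre : (w ^ 2).re = w.re * w.re - w.im * w.im := by rw [pow_two, Complex.mul_re]
    have him : (w ^ 2).im = 2 * (w.re * w.im) := by rw [pow_two, Complex.mul_im]; ring
    have hq' : (w ^ 2) = algebraMap ℚ ℂ (b ^ 2 * q) := hx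
    have hre0 : 0 ≤ (w ^ 2).re := by
      rw [hq', eq_ratCast, Complex.ratCast_re]
      exact_mod_cast mul_nonneg (sq_nonneg b) hq
    have him0 : (w ^ 2).im = 0 := by rw [hq', eq_ratCast, Complex.ratCast_im]
    rw [him] at him0
    have hwim : w.im = 0 := by
      rcases mul_eq_zero.1 (by linarith : w.re * w.im = 0) with h | h
      · rw [hre, h, zero_mul, zero_sub] at hre0
        nlinarith [mul_self_nonneg w.im]
      · exact h
    have : x = w + algebraMap ℚ ℂ a := by rw [hw, sub_add_cancel]
    rw [this, Complex.add_im, hwim, eq_ratCast, Complex.ratCast_im, add_zero]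

/-! ## §3 The simple quaternion fourfold has Mumford–Tate rank `7` -/

/-- **A simple complex abelian FOURFOLD `B` with `dim_ℚ End⁰B = 8` and centre `⊆ ℚ + ℚφ`, `φ² = q ≥ 0`, has `dim MT(H¹B) = 7`**,
no factor of type IV, `𝔷 = Lie Hg ∩ End_Hdg = 0`, and is not of CM type.  Counting: `H¹(B)` is free of rank one over `End⁰B`,
so `dim Lie Hg(H¹B) + 1 ≤ 2 dim B = 8` (`finrank_hodgeLie_add_one_le_two_mul_dim_of_isSimple`); no type IV ⟹ `t ∉ {5,6,8}` and
`t ≥ 4`; `t = 4` ⟹ `dim End⁰B = 16`.  This is Moonen–Zarhin's `Hg(B) ⊆ Sp_D(V,φ)` for the quaternion fourfold over a real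
quadratic field (`dim = 6`), read with the tree's small-rank ladder. [cite: MoonenZarhin1999LowDim, §1 and §2 (2.3)]
[cite: MumfordAV1970, §19 Cor. 2 (p. 174) and §21] [cite: Deligne1982HodgeCycles, I Prop. 3.4 and 3.6] -/
theorem mtRank_hodge_one_eq_seven_of_isSimple_fourfold_of_finrank_endAlgebra_eq_eight {B : AbelianVariety ℂ} {k : ℕ}
    (hB : IsSmoothProjective k B.X) (hBs : B.IsSimple) (hB4 : B.dim = 4) (hE8 : Module.finrank ℚ B.endAlgebra = 8)
    {φ : B.endAlgebra} {q : ℚ} (hq : 0 ≤ q) (hφ : φ * φ = algebraMap ℚ B.endAlgebra q)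
    (hZ : ∀ z ∈ Subalgebra.center ℚ B.endAlgebra, ∃ a b : ℚ, z = algebraMap ℚ B.endAlgebra a + b • φ) :
    haveI := BettiUniverse.finite hB 1
    (BettiUniverse.hodge exists_isReal_hodgeModel_holds hB 1).mtRank = 7 ∧ HasNoTypeIVFactor B ∧
      (BettiUniverse.hodge exists_isReal_hodgeModel_holds hB 1).hodgeLie ⊓
        Subalgebra.toSubmodule (BettiUniverse.hodge exists_isReal_hodgeModel_holds hB 1).endAlg = ⊥ ∧
      ¬ IsOfCMType B := by
  have hk : B.dim = k := schemeDim_eq_holds hB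
  subst hk
  haveI := BettiUniverse.finite hB 1
  have hB0 : 0 < B.dim := by omega
  have hA4 : HasNoTypeIVFactor B := hasNoTypeIVFactor_of_center_real_quadratic hq hφ hZ
  have hz := hodgeLie_hodge_one_inf_endAlg_eq_bot_of_hasNoTypeIVFactor hB hA4
  have hcm : ¬ IsOfCMType B := not_isOfCMType_of_hasNoTypeIVFactor hB hB0 hA4
  -- `t ≤ 8`: `H¹(B)` is free of rank one over `End⁰B` (the two proofs of `IsSmoothProjective B.dim B.X` agree)
  have h8 : Module.finrank ℚ (BettiUniverse.hodge exists_isReal_hodgeModel_holds hB 1).hodgeLie + 1 ≤ 2 * B.dim :=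
    finrank_hodgeLie_add_one_le_two_mul_dim_of_isSimple hBs hB0 (by rw [hE8, hB4])
  have ht := mtRank_hodge_one_eq_finrank_hodgeLie_add_one hB hB0
  -- `t ∉ {5, 6, 8}`, `t ≥ 4`, `t ≠ 4`
  obtain ⟨-, -, h5, h6, h8'⟩ := mtRank_hodge_one_ne_of_hasNoTypeIVFactor hB hB0 hA4
  have h4 := four_le_mtRank_hodge_one_of_not_isOfCMType hB hcm
  have hne4 : (BettiUniverse.hodge exists_isReal_hodgeModel_holds hB 1).mtRank ≠ 4 := by
    intro h
    obtain ⟨hsq, -, -⟩ := finrank_endAlgebra_eq_dim_sq_of_not_isOfCMType hB hB0 hcm h.le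
    rw [hE8, hB4] at hsq
    norm_num at hsq
  refine ⟨?_, hA4, hz, hcm⟩
  omega

/-! ## §4 Powers: `X ∼ B^{m+1}` -/

/-- **Every `X ∼ B^{m+1}` with `B` a simple quaternion fourfold as above has `dim MT(H¹X) = 7`, NO factor of type IV, `𝔷 = 0`,
is NOT of CM type, and `Lie Hg(H¹X)` is `ℚ`-SIMPLE.**  `dim Lie Hg(H¹X) ≤ dim Lie Hg(H¹B) = 6` (`Hg(Bⁿ) ⊆ Hg(B)`), `X` inherits
«no type IV» (`HasNoTypeIVFactor.of_isIsogenous_powSucc`), `t(X) = 4` would force `dim_ℚ End⁰X = (dim X)² = 16(m+1)²` against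
`dim_ℚ End⁰X = 8(m+1)²`; simplicity: gen 39's split alternative `X ∼ B₁^{a+1} × B₂^{b+1}` has simple factors of dimension `≤ 2`,
but the simple `B ≼ X` would be isogenous to one of them. [cite: MoonenZarhin1999LowDim, §1, §2 (2.3) and §3 (3.1)]
[cite: MumfordAV1970, §19 Thm. 1, Cor. 1–2 (pp. 173–174)] -/
theorem mtRank_hodge_one_eq_seven_of_isIsogenous_powSucc_quaternionFourfold (hX : IsSmoothProjective n X.X)
    {B : AbelianVariety ℂ} (hBs : B.IsSimple) (hB4 : B.dim = 4) (hE8 : Module.finrank ℚ B.endAlgebra = 8)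
    {φ : B.endAlgebra} {q : ℚ} (hq : 0 ≤ q) (hφ : φ * φ = algebraMap ℚ B.endAlgebra q)
    (hZ : ∀ z ∈ Subalgebra.center ℚ B.endAlgebra, ∃ a b : ℚ, z = algebraMap ℚ B.endAlgebra a + b • φ) {m : ℕ}
    (hXB : IsIsogenous X (B.powSucc m)) :
    haveI := BettiUniverse.finite hX 1
    letI : LieRing (Module.End ℚ (bettiCohomology X.X 1)) := LieRing.ofAssociativeRing
    (BettiUniverse.hodge exists_isReal_hodgeModel_holds hX 1).mtRank = 7 ∧ HasNoTypeIVFactor X ∧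
      (BettiUniverse.hodge exists_isReal_hodgeModel_holds hX 1).hodgeLie ⊓
        Subalgebra.toSubmodule (BettiUniverse.hodge exists_isReal_hodgeModel_holds hX 1).endAlg = ⊥ ∧
      ¬ IsOfCMType X ∧
      ∀ 𝔏 : LieSubalgebra ℚ (Module.End ℚ (bettiCohomology X.X 1)),
        𝔏.toSubmodule = (BettiUniverse.hodge exists_isReal_hodgeModel_holds hX 1).hodgeLie → LieAlgebra.IsSimple ℚ 𝔏 := by
  classical
  haveI := BettiUniverse.finite hX 1
  have hsp : ∀ A : AbelianVariety ℂ, IsSmoothProjective A.dim A.X := fun A => AbelianVariety.isSmoothProjective_holds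
  haveI := BettiUniverse.finite (hsp B) 1
  have hB0 : 0 < B.dim := by omega
  obtain ⟨h7B, hA4B, -, -⟩ :=
    mtRank_hodge_one_eq_seven_of_isSimple_fourfold_of_finrank_endAlgebra_eq_eight (hsp B) hBs hB4 hE8 hq hφ hZ
  -- no type IV for `X`, `𝔷 = 0`, not CM
  have hA4 : HasNoTypeIVFactor X := hA4B.of_isIsogenous_powSucc hXB
  have hz := hodgeLie_hodge_one_inf_endAlg_eq_bot_of_hasNoTypeIVFactor hX hA4
  have hXP : IsIsogenous X (⨁ fun _ : Fin (m + 1) => B) := hXB.trans (isIsogenous_powSucc_biproduct B m)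
  obtain ⟨f, hf⟩ := hXP
  have h0 : 0 < X.dim := by
    rw [dim_eq_of_isIsogeny hf, AndreRiemann.dim_biproduct_const]; positivity
  have hcm : ¬ IsOfCMType X := not_isOfCMType_of_hasNoTypeIVFactor hX h0 hA4
  -- `t(X) ≤ 7`: `dim 𝔥(X) = dim 𝔥(⨁ B) ≤ dim 𝔥(B) = 6`
  have htB := mtRank_hodge_one_eq_finrank_hodgeLie_add_one (hsp B) hB0
  have h1 := AbelianVariety.finrank_hodgeLie_hodge_one_eq_of_isIsogenous hX (hsp (⨁ fun _ : Fin (m + 1) => B)) ⟨f, hf⟩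
  have h2 := AbelianVariety.finrank_hodgeLie_hodge_one_biproduct_const_le (hsp B) (hsp (⨁ fun _ : Fin (m + 1) => B))
    (a := m)
  have ht := mtRank_hodge_one_eq_finrank_hodgeLie_add_one hX h0
  -- `t(X) ∉ {5,6}`, `t(X) ≥ 4`, `t(X) ≠ 4`
  obtain ⟨-, -, h5, h6, -⟩ := mtRank_hodge_one_ne_of_hasNoTypeIVFactor hX h0 hA4
  have h4 := four_le_mtRank_hodge_one_of_not_isOfCMType hX hcm
  have hne4 : (BettiUniverse.hodge exists_isReal_hodgeModel_holds hX 1).mtRank ≠ 4 := by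
    intro h
    obtain ⟨hsq, -, -⟩ := finrank_endAlgebra_eq_dim_sq_of_not_isOfCMType hX h0 hcm h.le
    have hE : Module.finrank ℚ X.endAlgebra = (m + 1) ^ 2 * Module.finrank ℚ B.endAlgebra := by
      rw [IsIsogenous.finrank_endAlgebra_eq ⟨f, hf⟩, EndAlgebraPower.finrank_endAlgebra_biproduct]
    have hd : X.dim = (m + 1) * B.dim := by rw [dim_eq_of_isIsogeny hf, AndreRiemann.dim_biproduct_const]
    rw [hE, hd, hE8, hB4] at hsq
    have : (m + 1) ^ 2 * 8 = (m + 1) ^ 2 * 16 := by rw [hsq]; ring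
    have hpos : 0 < (m + 1) ^ 2 := by positivity
    omega
  have h7 : (BettiUniverse.hodge exists_isReal_hodgeModel_holds hX 1).mtRank = 7 := by omega
  refine ⟨h7, hA4, hz, hcm, ?_⟩
  -- simplicity: the split alternative is excluded
  rcases isSimple_or_exists_isIsogenous_powSucc_prod_powSucc_of_center_eq_bot_of_mtRank_eq_seven hX h0 hz h7 with h | h
  · exact h
  · exfalso
    obtain ⟨B₁, B₂, a, b, hB₁s, hB₂s, hB₁0, hB₁2, hB₂0, hB₂2, -, -, -, -, -, -, -, -, -, ⟨g, hg⟩, -, -⟩ := h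
    -- `B ≼ X ∼ B₁^{a+1} × B₂^{b+1} ≼ ⨁ (B₁ … B₁, B₂ … B₂)`: the simple `B` is isogenous to `B₁` or `B₂`, of dimension `≤ 2`
    obtain ⟨g', hg'⟩ := hXB
    have hdomB : AVDominatedBy B X := (avDominatedBy_powSucc_of_le B (Nat.zero_le m)).trans_isIsogeny_inv hg'
    have hdomP : AVDominatedBy ((B₁.powSucc a).prod (B₂.powSucc b))
        (⨁ AndreRiemann.sumFam (fun _ : Fin (a + 1) => B₁) (fun _ : Fin (b + 1) => B₂)) :=
      AndreRiemann.avDominatedBy_prod_of_biproduct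
        (AVDominatedBy.of_isIsogenous (isIsogenous_biproduct_powSucc B₁ a).symm' (AVDominatedBy.refl _))
        (AVDominatedBy.of_isIsogenous (isIsogenous_biproduct_powSucc B₂ b).symm' (AVDominatedBy.refl _))
    have hsimple' : ∀ j, (AndreRiemann.sumFam (fun _ : Fin (a + 1) => B₁) (fun _ : Fin (b + 1) => B₂) j).IsSimple := by
      rintro (j | j)
      · exact hB₁s
      · exact hB₂s
    obtain ⟨j, hj⟩ := exists_isIsogenous_of_isSimple_of_avDominatedBy_biproduct hsimple' hBs hB0
      ((hdomB.trans_isIsogeny_hom hg).trans hdomP)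
    rcases j with j | j
    · have hj' : IsIsogenous B B₁ := hj
      obtain ⟨u, hu⟩ := hj'
      have hd := dim_eq_of_isIsogeny hu
      omega
    · have hj' : IsIsogenous B B₂ := hj
      obtain ⟨u, hu⟩ := hj'
      have hd := dim_eq_of_isIsogeny hu
      omega

end Summit.HodgeConjecture.CorCM

end
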